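import Literature.Analysis.FluidPDE.PassiveVectorGalerkinWeakForm
import Literature.Analysis.FluidPDE.PassiveVector
import HarnessLib

/-!
# The Fourier–Galerkin scheme for the passive solenoidal vector (`A = 0`) with a trigonometric-polynomial
  carrier, IV: bookkeeping of the carrier and of the Galerkin limit for the weak class

Analysis/FluidPDE proof-support file (theorems only; no named facts), sequel of `PassiveVectorGalerkinWeakForm`.
It verifies, for a trigonometric-polynomial carrier `b` (`Torus.TrigPolyCarrier`) and a Galerkin limit `w`
(`Torus.PVSetup.IsGalerkinLimit`), the bookkeeping clauses of the weak class `Torus.IsWeakPassiveVectorOn 0 T κ b w₀ w`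
of `PassiveVector.lean` (Yoshida–Kaneda 2000, (4)–(5); DiPerna–Lions 1989, §II.1 (12)–(14)): joint
measurability of `w` and `b`, the bound `w ∈ L^∞(0,T; L²)`, `b ∈ L¹(0,T; L²)`, `‖b‖‖w‖ ∈ L¹`, weak
divergence-freeness of carrier and solution slices. The weak formulation itself (limit of
`PVSetup.galerkin_weak_identity`) is the object of the sequel.

## References

* K. Yoshida, Y. Kaneda, Phys. Rev. E 63 (2000) 016308, §II eq. (4)–(5). [`YoshidaKaneda2000`]
* R. J. DiPerna, P.-L. Lions, Invent. Math. 98 (1989) 511–547, §II.1 (12)–(14). [`DiPernaLions1989`]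
* J. C. Robinson, J. L. Rodrigo, W. Sadowski, *The three-dimensional Navier–Stokes equations* (CUP 2016),
  Thm. 4.4. [`RobinsonRodrigoSadowski2016`]
-/

open MeasureTheory Set Filter Topology UnitAddTorus Metric Function
open scoped ENNReal NNReal InnerProductSpace

noncomputable section

namespace Literature.Analysis.FluidPDE

namespace Torus

open FunctionSpaces.Torus FunctionSpaces

variable {d : Type*} [Fintype d] [DecidableEq d]

/-! ## The carrier: pointwise bound, joint continuity, divergence-freeness -/

section Carrier

variable {b : ℝ → UnitAddTorus d → EuclideanSpace ℝ d} {B : Finset (d → ℤ)}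
  {β : ℝ → (d → ℤ) → EuclideanSpace ℂ d} {C : ℝ}

omit [DecidableEq d] in
/-- **Pointwise bound of a trigonometric-polynomial carrier**: `‖b t x‖ ≤ #B · max C 0`. [cite: RobinsonRodrigoSadowski2016, Thm. 4.4 Step 1 (4.5)] -/
theorem TrigPolyCarrier.norm_apply_le (hc : TrigPolyCarrier b B β C) (t : ℝ) (x : UnitAddTorus d) :
    ‖b t x‖ ≤ B.card * max C 0 := by
  rw [hc.eq t, norm_realTrigPoly_apply hc.symm (hc.conjSymm t), trigPoly_apply]
  refine (norm_sum_le _ _).trans ?_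
  calc ∑ k ∈ B, ‖mFourier k x • β t k‖ ≤ ∑ k ∈ B, max C 0 := Finset.sum_le_sum fun k _ => by
        rw [norm_smul]
        calc ‖mFourier k x‖ * ‖β t k‖ ≤ 1 * max C 0 :=
              mul_le_mul ((mFourier k).norm_coe_le_norm x |>.trans_eq mFourier_norm) (hc.norm_le_max t k)
                (norm_nonneg _) zero_le_one
          _ = max C 0 := one_mul _
    _ = B.card * max C 0 := by rw [Finset.sum_const, nsmul_eq_mul]

omit [DecidableEq d] in
/-- **Joint continuity of a trigonometric-polynomial carrier** on `ℝ × T^d` (finite sum of characters with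
continuous coefficients). [cite: RobinsonRodrigoSadowski2016, Thm. 4.4 Step 1 (4.5)] -/
theorem TrigPolyCarrier.continuous_uncurry (hc : TrigPolyCarrier b B β C) : Continuous (uncurry b) := by
  have e : uncurry b = fun p : ℝ × UnitAddTorus d =>
      EuclideanSpace.realPart (∑ k ∈ B, mFourier k p.2 • β p.1 k) := by
    funext ⟨t, x⟩
    rw [uncurry_apply_pair, hc.eq t, realTrigPoly_apply, trigPoly_apply]
  rw [e]
  refine EuclideanSpace.realPart.continuous.comp (continuous_finsetSum _ fun k _ => ?_)
  exact ((mFourier k).continuous.comp continuous_snd).smul ((hc.continuous k).comp continuous_fst)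

omit [DecidableEq d] in
/-- The space–time lift of the carrier is continuous. [cite: RobinsonRodrigoSadowski2016, Thm. 4.4 Step 1 (4.5)] -/
theorem TrigPolyCarrier.continuous_stLift (hc : TrigPolyCarrier b B β C) : Continuous (stLift b) := by
  have e : stLift b = uncurry b ∘ Prod.map id proj := by
    funext ⟨t, y⟩
    rfl
  rw [e]
  exact hc.continuous_uncurry.comp (continuous_id.prodMap continuous_proj)

omit [DecidableEq d] in
/-- **The carrier lies in `L^∞((0,T) × T^d)`** (through its space–time lift). [cite: DiPernaLions1989, §II.1 (12)–(14)] -/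
theorem TrigPolyCarrier.memLp_top_stLift (hc : TrigPolyCarrier b B β C) (T : ℝ) :
    MemLp (stLift b) ∞ (volume.restrict (Ioo 0 T ×ˢ (univ : Set (EuclideanSpace ℝ d)))) :=
  memLp_top_of_bound hc.continuous_stLift.aestronglyMeasurable (B.card * max C 0)
    (ae_of_all _ fun p => hc.norm_apply_le p.1 (proj p.2))

omit [DecidableEq d] in
/-- Every slice of the carrier is smooth. [cite: RobinsonRodrigoSadowski2016, Thm. 4.4 Step 1 (4.5)] -/
theorem TrigPolyCarrier.isSmooth (hc : TrigPolyCarrier b B β C) (t : ℝ) : IsSmooth (b t) := by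
  rw [hc.eq t]; exact isSmooth_realTrigPoly _ _

/-- Every slice of the carrier is (classically) divergence free. [cite: ConstantinFoias1988, Ch. 8 (8.3)–(8.5)] -/
theorem TrigPolyCarrier.isDivFree (hc : TrigPolyCarrier b B β C) (t : ℝ) : IsDivFree (b t) := by
  rw [hc.eq t]; exact isDivFree_realTrigPoly fun k _ => hc.transversal t k

/-- Every slice of the carrier is weakly divergence free (transversal Fourier coefficients). [cite: RobinsonRodrigoSadowski2016, Lemma 2.3] -/
theorem TrigPolyCarrier.isWeaklyDivFree (hc : TrigPolyCarrier b B β C) (t : ℝ) :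
    FunctionSpaces.Torus.IsWeaklyDivFree (b t) := by
  refine Torus.isWeaklyDivFree_of_sum_mul_mFourierCoeff_eq_zero ((hc.isSmooth t).memLp 2) fun k => ?_
  rw [hc.eq t, mFourierCoeff_realTrigPoly hc.symm (hc.conjSymm t)]
  split_ifs
  · exact hc.transversal t k
  · simp

omit [DecidableEq d] in
/-- Every slice of the carrier is in `L²` with `∫⁻ ‖b t‖ₑ² ≤ (#B · max C 0)²`. [cite: DiPernaLions1989, §II.1 (12)–(14)] -/
theorem TrigPolyCarrier.lintegral_enorm_sq_le (hc : TrigPolyCarrier b B β C) (t : ℝ) :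
    ∫⁻ x, ‖b t x‖ₑ ^ 2 ≤ ENNReal.ofReal ((B.card * max C 0) ^ 2) := by
  have hK : 0 ≤ (B.card : ℝ) * max C 0 := by positivity
  calc ∫⁻ x, ‖b t x‖ₑ ^ 2 ≤ ∫⁻ _ : UnitAddTorus d, ENNReal.ofReal ((B.card * max C 0) ^ 2) := by
        refine lintegral_mono fun x => ?_
        rw [← ofReal_norm, ← ENNReal.ofReal_pow (norm_nonneg _)]
        exact ENNReal.ofReal_le_ofReal (pow_le_pow_left₀ (norm_nonneg _) (hc.norm_apply_le t x) 2)
    _ = ENNReal.ofReal ((B.card * max C 0) ^ 2) := by rw [lintegral_const, measure_univ, mul_one]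

end Carrier

/-! ## The Galerkin limit: the bookkeeping clauses of the weak class -/

section LimitBookkeeping

variable {b : ℝ → UnitAddTorus d → EuclideanSpace ℝ d} {B : Finset (d → ℤ)}
  {β : ℝ → (d → ℤ) → EuclideanSpace ℂ d} {C κ : ℝ} {Sec : Set (d → ℤ)}
  {w₀ : UnitAddTorus d → EuclideanSpace ℝ d}
  {h : PVSetup κ b B β C Sec w₀} {φ : ℕ → ℕ} {c : ℝ → (d → ℤ) → EuclideanSpace ℂ d}
  {w : ℝ → UnitAddTorus d → EuclideanSpace ℝ d}

/-- Joint measurability of the limit on `(0,T) × ℝ^d` (restriction from `(0,∞) × ℝ^d`). [cite: DiPernaLions1989, §II.1 (12)–(14)] -/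
theorem PVSetup.IsGalerkinLimit.aestronglyMeasurable_Ioo (hl : h.IsGalerkinLimit φ c w) (T : ℝ) :
    AEStronglyMeasurable (stLift w) (volume.restrict (Ioo 0 T ×ˢ (univ : Set (EuclideanSpace ℝ d)))) :=
  hl.aestronglyMeasurable.mono_measure (Measure.restrict_mono (prod_mono Ioo_subset_Ioi_self subset_rfl) le_rfl)

omit [DecidableEq d] in
/-- `∫⁻ ‖f‖ₑ² = ofReal (∫ ‖f‖²)` for `f ∈ L²` (local copy). [folklore] -/
private theorem lintegral_enorm_sq_eq_ofReal_vec {f : UnitAddTorus d → EuclideanSpace ℝ d} (hf : MemLp f 2 volume) :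
    ∫⁻ x, ‖f x‖ₑ ^ 2 = ENNReal.ofReal (∫ x, ‖f x‖ ^ 2) := by
  rw [ofReal_integral_eq_lintegral_ofReal (hf.integrable_norm_pow two_ne_zero) (ae_of_all _ fun x => by positivity)]
  refine lintegral_congr fun x => ?_
  rw [← ofReal_norm, ← ENNReal.ofReal_pow (norm_nonneg _)]

/-- **`L^∞_t L²_x` bound of the limit**: `∫⁻ ‖w(t)‖ₑ² ≤ ofReal (∫‖w₀‖²)` for every `t > 0`, in particular
for a.e. `t ∈ (0,T)`. [cite: RobinsonRodrigoSadowski2016, Thm. 4.6] -/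
theorem PVSetup.IsGalerkinLimit.ae_lintegral_sq_le (hl : h.IsGalerkinLimit φ c w) (T : ℝ) :
    ∀ᵐ t ∂(volume.restrict (Ioo 0 T)), ∫⁻ x, ‖w t x‖ₑ ^ 2 ≤ (Real.toNNReal (∫ x, ‖w₀ x‖ ^ 2) : ℝ≥0∞) := by
  filter_upwards [ae_restrict_mem measurableSet_Ioo] with t ht
  rw [lintegral_enorm_sq_eq_ofReal_vec (hl.memLp t ht.1.le), ENNReal.ofNNReal_toNNReal]
  refine ENNReal.ofReal_le_ofReal ?_
  have := hl.integral_norm_sq_le (R := 0) (fun k _ _ => by rw [sq, zero_mul]; exact freqNormSq_nonneg k) ht.1.le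
  simpa using this

/-- `∫⁻ ‖w(t)‖ₑ ≤ ofReal (∫‖w₀‖²)^{1/2}` for `t ≥ 0` (`L¹ ≤ L²` on the probability space `T^d`). [cite: RobinsonRodrigoSadowski2016, Thm. 4.6] -/
theorem PVSetup.IsGalerkinLimit.lintegral_enorm_le (hl : h.IsGalerkinLimit φ c w) {t : ℝ} (ht : 0 ≤ t) :
    ∫⁻ x, ‖w t x‖ₑ ≤ ENNReal.ofReal (Real.sqrt (∫ x, ‖w₀ x‖ ^ 2)) := by
  have hm := hl.memLp t ht
  calc ∫⁻ x, ‖w t x‖ₑ = eLpNorm (w t) 1 volume := by rw [eLpNorm_one_eq_lintegral_enorm]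
    _ ≤ eLpNorm (w t) 2 volume := eLpNorm_le_eLpNorm_of_exponent_le (by norm_num) hm.1
    _ = (∫⁻ x, ‖w t x‖ₑ ^ 2) ^ (1 / (2 : ℝ)) := by
        rw [eLpNorm_eq_lintegral_rpow_enorm_toReal two_ne_zero ENNReal.ofNat_ne_top, ENNReal.toReal_ofNat]
        congr 1
        exact lintegral_congr fun x => by rw [← ENNReal.rpow_two]
    _ ≤ ENNReal.ofReal (Real.sqrt (∫ x, ‖w₀ x‖ ^ 2)) := by
        have h0 : 0 ≤ ∫ x, ‖w t x‖ ^ 2 := integral_nonneg fun x => by positivity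
        have hb : ∫ x, ‖w t x‖ ^ 2 ≤ ∫ x, ‖w₀ x‖ ^ 2 := by
          have := hl.integral_norm_sq_le (R := 0) (fun k _ _ => by rw [sq, zero_mul]; exact freqNormSq_nonneg k) ht
          simpa using this
        rw [lintegral_enorm_sq_eq_ofReal_vec hm, ENNReal.ofReal_rpow_of_nonneg h0 (by norm_num : (0:ℝ) ≤ 1 / 2),
          Real.sqrt_eq_rpow]
        exact ENNReal.ofReal_le_ofReal (Real.rpow_le_rpow h0 hb (by norm_num))

omit [DecidableEq d] in
/-- **`b ∈ L¹(0,T; L²)`** for a trigonometric-polynomial carrier (bounded). [cite: DiPernaLions1989, §II.1 (12)–(14)] -/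
theorem TrigPolyCarrier.lintegral_carrier_lt_top (hc : TrigPolyCarrier b B β C) (T : ℝ) :
    ∫⁻ t in Ioo 0 T, (∫⁻ x, ‖b t x‖ₑ ^ 2) ^ (1 / 2 : ℝ) < ∞ := by
  calc ∫⁻ t in Ioo 0 T, (∫⁻ x, ‖b t x‖ₑ ^ 2) ^ (1 / 2 : ℝ)
      ≤ ∫⁻ _ in Ioo 0 T, (ENNReal.ofReal ((B.card * max C 0) ^ 2)) ^ (1 / 2 : ℝ) :=
        lintegral_mono fun t => ENNReal.rpow_le_rpow (hc.lintegral_enorm_sq_le t) (by norm_num)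
    _ < ∞ := by
        rw [setLIntegral_const]
        exact ENNReal.mul_lt_top (ENNReal.rpow_lt_top_of_nonneg (by norm_num) ENNReal.ofReal_ne_top) measure_Ioo_lt_top

/-- **`‖b‖‖w‖ ∈ L¹((0,T) × T^d)`** for the Galerkin limit (bounded carrier, `w ∈ L^∞_t L²_x ⊆ L^∞_t L¹_x`). [cite: DiPernaLions1989, §II.1 (12)–(14)] -/
theorem PVSetup.IsGalerkinLimit.lintegral_mul_lt_top (hl : h.IsGalerkinLimit φ c w) (T : ℝ) :
    ∫⁻ t in Ioo 0 T, ∫⁻ x, ‖b t x‖ₑ * ‖w t x‖ₑ < ∞ := by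
  have hc := h.carrier
  set K : ℝ≥0∞ := ENNReal.ofReal (B.card * max C 0) * ENNReal.ofReal (Real.sqrt (∫ x, ‖w₀ x‖ ^ 2)) with hK
  have hbd : ∀ t, 0 ≤ t → ∫⁻ x, ‖b t x‖ₑ * ‖w t x‖ₑ ≤ K := by
    intro t ht
    calc ∫⁻ x, ‖b t x‖ₑ * ‖w t x‖ₑ ≤ ∫⁻ x, ENNReal.ofReal (B.card * max C 0) * ‖w t x‖ₑ :=
          lintegral_mono fun x => by
            have hbx : ‖b t x‖ₑ ≤ ENNReal.ofReal (B.card * max C 0) := by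
              rw [← ofReal_norm]
              exact ENNReal.ofReal_le_ofReal (hc.norm_apply_le t x)
            gcongr
      _ = ENNReal.ofReal (B.card * max C 0) * ∫⁻ x, ‖w t x‖ₑ := lintegral_const_mul' _ _ ENNReal.ofReal_ne_top
      _ ≤ K := by
          rw [hK]
          gcongr
          exact hl.lintegral_enorm_le ht
  calc ∫⁻ t in Ioo 0 T, ∫⁻ x, ‖b t x‖ₑ * ‖w t x‖ₑ ≤ ∫⁻ _ in Ioo 0 T, K :=
        lintegral_mono_ae (by
          filter_upwards [ae_restrict_mem measurableSet_Ioo] with t ht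
          exact hbd t ht.1.le)
    _ < ∞ := by
        rw [setLIntegral_const]
        exact ENNReal.mul_lt_top (ENNReal.mul_lt_top ENNReal.ofReal_lt_top ENNReal.ofReal_lt_top) measure_Ioo_lt_top

end LimitBookkeeping

/-! ## Convergence of the datum term -/

section Datum

/-- **The truncated data converge weakly**: `∫⟪P_N u, a⟫ → ∫⟪u, a⟫` as `N → ∞` for `u, a ∈ L²(T^d; ℝ^d)`
(partial sums of the Parseval series over the balls `freqBall N`). [cite: Grafakos2014, Prop. 3.2.7 (3)] -/
theorem tendsto_integral_inner_fourierTruncate_left {u a : UnitAddTorus d → EuclideanSpace ℝ d}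
    (hu : MemLp u 2 volume) (ha : MemLp a 2 volume) :
    Tendsto (fun N => ∫ x, ⟪fourierTruncate N u x, a x⟫_ℝ) atTop (𝓝 (∫ x, ⟪u x, a x⟫_ℝ)) := by
  have h := hasSum_re_inner_mFourierCoeff_complexify hu ha
  have h2 := h.comp tendsto_freqBall_atTop
  refine h2.congr fun N => ?_
  rw [Function.comp_apply, integral_inner_fourierTruncate_left (hu.integrable one_le_two) ha]

/-- Along a subsequence `φ` (strictly monotone), the same convergence. [cite: Grafakos2014, Prop. 3.2.7 (3)] -/
theorem tendsto_integral_inner_fourierTruncate_left_subseq {u a : UnitAddTorus d → EuclideanSpace ℝ d}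
    (hu : MemLp u 2 volume) (ha : MemLp a 2 volume) {φ : ℕ → ℕ} (hφ : StrictMono φ) :
    Tendsto (fun n => ∫ x, ⟪fourierTruncate (φ n) u x, a x⟫_ℝ) atTop (𝓝 (∫ x, ⟪u x, a x⟫_ℝ)) :=
  (tendsto_integral_inner_fourierTruncate_left hu ha).comp hφ.tendsto_atTop

end Datum

end Torus

end Literature.Analysis.FluidPDE
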